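import Mathlib
import HarnessLib
import Summits.AtomisticToContinuum.FouriersLaw.Theses.JunctionLocality
import Summits.AtomisticToContinuum.FouriersLaw.Theorems.JunctionLocalityDefs
import Summits.AtomisticToContinuum.FouriersLaw.Theorems.JunctionLocalityConductanceLowerBoundStubEscapeFloorAux1
import Summits.AtomisticToContinuum.FouriersLaw.Theorems.BondHeatUncertaintyLightConeBondHeatGibbsByParts
import Summits.AtomisticToContinuum.FouriersLaw.Theorems.BondHeatUncertaintyLinearResponseFTURSteadyHeatRatesHelper3
import Literature.MathematicalPhysics.KineticTheory.VelocityFlipNoise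

/-!
# Short-time dipole floor, helper 4: Gibbs statics of the contact power pairing

Helper (`--supports stmt-AtomisticToContinuum-11749`) for stub `stub_shortTimeDipoleFloor` (S) of line
`kick-dipole-no-collapse`, crux `JunctionLocality.ConductanceLowerBound`.

For the pinned anharmonic chain `P = pinnedChain ω₂ lam β γ` (all parameters `> 0`), `T > 0`, `N ≥ 2`, the Gibbs measure `μ_T`,
the contact power `a₀ = p_0 ∂_{q_0}H` and the total current `J = Σ_i j_i`:

  `∫ a₀ · J dμ_T = (T²/2) ∫ V''(q_1 − q_0) dμ_T ≥ T²/2`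

(`helper_kdContactPowerStatics`).  Mechanism: only the contact bond `j_0 = −½(p_0 + p_1)V'(q_1 − q_0)` pairs with `a₀` (every
other bond current is even under the flip `p_0 ↦ −p_0`, `a₀` is odd, the Gibbs measure is flip invariant,
`measurePreserving_momentumFlip_gibbsMeasure`); the cross term `p_0 p_1` dies under `p_1 ↦ −p_1`; `p_0²` integrates to `T`
against a configurational weight (`LightConeBondHeat.pinnedChain_integral_momentum_sq_mul_posFun`); and one integration by parts in
`q_0` (`SubdiffusiveBondHeat.integral_mul_eq_neg_of_hasLineDerivAt_of_integrable`, `∂_{q_0} e^{−H/T} = −(∂_{q_0}H/T) e^{−H/T}`) turns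
`∫ ∂_{q_0}H · V'(q_1 − q_0) e^{−H/T}` into `−T ∫ V''(q_1 − q_0) e^{−H/T}`, with `V'' = 1 + 3βr² ≥ 1`.
-/

noncomputable section

open MeasureTheory ProbabilityTheory Filter Topology Set
open scoped NNReal ENNReal BigOperators
open Literature.MathematicalPhysics.KineticTheory.HeatConduction
open Summit.AtomisticToContinuum.FouriersLaw.Theorems.JunctionLocality
open Summit.AtomisticToContinuum.FouriersLaw.Theorems
open Summit.AtomisticToContinuum.FouriersLaw.Theorems.SubdiffusiveBondHeat

namespace Summit.AtomisticToContinuum.FouriersLaw.Cruxes.ConductanceLowerBound.KickDipoleNoCollapse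

variable {N : ℕ}

/-! ### Single-momentum parity -/

/-- An integrand that is odd under the flip of one momentum integrates to zero against any Gibbs measure. -/
theorem integral_eq_zero_of_momentumFlip_odd (P : OscillatorChain) (N : ℕ) (T : ℝ) (i : Fin N) {F : PhaseSpace N → ℝ}
    (hF : ∀ x, F (momentumFlip i x) = -F x) : ∫ x, F x ∂(P.gibbsMeasure N T) = 0 := by
  have hmp := P.measurePreserving_momentumFlip_gibbsMeasure N T i
  have h := hmp.integral_comp (momentumFlipEquiv i).measurableEmbedding F
  simp only [hF, integral_neg] at h
  linarith

/-- `∂_{q_i}H` is unchanged by a momentum flip (it depends on the positions only). -/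
theorem partialQ_hamiltonian_momentumFlip (P : OscillatorChain) (i j : Fin N) (x : PhaseSpace N) :
    partialQ i (P.hamiltonian N) (momentumFlip j x) = partialQ i (P.hamiltonian N) x := by
  rw [P.partialQ_hamiltonian_eq, P.partialQ_hamiltonian_eq, momentumFlip_fst]

/-- A bond current not touching site `0` is unchanged by the flip of `p_0`. -/
theorem bondCurrent_momentumFlip_zero_of_ne (P : OscillatorChain) (hN : 0 < N) {i : Fin N} (hi : i.val ≠ 0)
    (x : PhaseSpace N) : P.bondCurrent N i (momentumFlip ⟨0, hN⟩ x) = P.bondCurrent N i x := by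
  unfold OscillatorChain.bondCurrent
  refine Finset.sum_congr rfl fun j _ => ?_
  split_ifs with hj
  · have hi' : i ≠ ⟨0, hN⟩ := fun h => hi (by rw [h])
    have hj' : j ≠ ⟨0, hN⟩ := fun h => by rw [h] at hj; simp at hj
    rw [momentumFlip_snd_of_ne hi', momentumFlip_snd_of_ne hj', momentumFlip_fst]
  · rfl

section Pinned

variable {ω₂ lam β γ : ℝ} (hω : 0 < ω₂) (hl : 0 < lam) (hβ : 0 < β) (hγ : 0 < γ) (hN : 0 < N) {T : ℝ} (hT : 0 < T)
include hω hl hβ hγ hN hT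

omit hω hl hβ hγ hT in
/-- The contact power paired with a bond current not touching site `0` vanishes (odd under `p_0 ↦ −p_0`). -/
theorem integral_contactPower_mul_bondCurrent_of_ne {i : Fin N} (hi : i.val ≠ 0) :
    ∫ x, (x.2 ⟨0, hN⟩ * partialQ ⟨0, hN⟩ ((pinnedChain ω₂ lam β γ).hamiltonian N) x) *
        (pinnedChain ω₂ lam β γ).bondCurrent N i x ∂((pinnedChain ω₂ lam β γ).gibbsMeasure N T) = 0 := by
  refine integral_eq_zero_of_momentumFlip_odd _ N T ⟨0, hN⟩ fun x => ?_
  rw [partialQ_hamiltonian_momentumFlip, bondCurrent_momentumFlip_zero_of_ne _ hN hi, momentumFlip_snd_self]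
  ring

/-- **The contact bond.**  For `N ≥ 2`:
`∫ (p_0 ∂_{q_0}H) · j_0 dμ_T = (T²/2) ∫ (1 + 3β(q_1 − q_0)²) dμ_T` (`V''(r) = 1 + 3βr²`). -/
theorem integral_contactPower_mul_bondCurrent_zero (hN2 : 2 ≤ N) :
    ∫ x, (x.2 ⟨0, hN⟩ * partialQ ⟨0, hN⟩ ((pinnedChain ω₂ lam β γ).hamiltonian N) x) *
        (pinnedChain ω₂ lam β γ).bondCurrent N ⟨0, hN⟩ x ∂((pinnedChain ω₂ lam β γ).gibbsMeasure N T) =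
      T ^ 2 / 2 * ∫ x, (1 + 3 * β * (x.1 ⟨1, hN2⟩ - x.1 ⟨0, hN⟩) ^ 2) ∂((pinnedChain ω₂ lam β γ).gibbsMeasure N T) := by
  set P := pinnedChain ω₂ lam β γ with hP
  set i0 : Fin N := ⟨0, hN⟩ with hi0
  set i1 : Fin N := ⟨1, hN2⟩ with hi1
  have h01 : i0 ≠ i1 := by intro h; have := congrArg Fin.val h; simp [hi0, hi1] at this
  have hconf := pinnedChain_isConfining hω hl.le hβ.le hγ.le
  obtain ⟨A, hA0, hA⟩ := hconf.exists_abs_deriv_U_le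
  obtain ⟨B, hB0, hB⟩ := hconf.exists_abs_deriv_V_le
  have hUd := hconf.differentiable_U
  have hVd := hconf.differentiable_V
  have hH0 : ∀ x : PhaseSpace N, 0 ≤ P.hamiltonian N x := fun x => pinnedChain_hamiltonian_nonneg hω.le hl.le hβ.le γ N x
  -- the bond current of bond `(0, 1)`
  have hj : ∀ x : PhaseSpace N, P.bondCurrent N i0 x =
      -((x.2 i0 + x.2 i1) / 2 * ((x.1 i1 - x.1 i0) + β * (x.1 i1 - x.1 i0) ^ 3)) := by
    intro x
    unfold OscillatorChain.bondCurrent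
    rw [Finset.sum_eq_single i1]
    · rw [if_pos (by simp [hi0, hi1]), pinnedChain_deriv_V]
    · intro j _ hj
      rw [if_neg]
      intro h
      exact hj (Fin.ext (by simp [hi0] at h; simp [hi1, h]))
    · intro h; exact absurd (Finset.mem_univ _) h
  -- `∂_{q_0}H` as a function of the positions
  have hdP : ∀ x : PhaseSpace N, partialQ i0 (P.hamiltonian N) x = P.dPotential N i0 x.1 := fun x => by
    rw [P.partialQ_hamiltonian_eq_dPotential hUd hVd]
  set G : (Fin N → ℝ) → ℝ := fun q => P.dPotential N i0 q * ((q i1 - q i0) + β * (q i1 - q i0) ^ 3) with hG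
  have hGc : Continuous G := by
    have h1 : Continuous fun q : Fin N → ℝ => P.dPotential N i0 q :=
      (P.contDiff_dPotential (pinnedChain_contDiff_U ω₂ lam β γ) (pinnedChain_contDiff_V ω₂ lam β γ) N i0).continuous
    exact h1.mul (by fun_prop)
  -- energy bounds
  have hVb : ∀ x : PhaseSpace N, |(x.1 i1 - x.1 i0) + β * (x.1 i1 - x.1 i0) ^ 3| ≤ B * (1 + P.hamiltonian N x) := by
    intro x
    have h1 := hB (x.1 i1 - x.1 i0)
    rw [pinnedChain_deriv_V] at h1
    have h2 := P.bond_le_hamiltonian hconf.U_nonneg hconf.V_nonneg N x (k := i0) (l := i1) (by simp [hi0, hi1])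
    exact h1.trans (mul_le_mul_of_nonneg_left (by linarith) hB0)
  have hGb : ∀ x : PhaseSpace N, |G x.1| ≤ (A + N ^ 2 * B) * B * (1 + P.hamiltonian N x) ^ 2 := by
    intro x
    rw [hG]
    dsimp only
    rw [abs_mul]
    have h1 := P.abs_dPotential_le hA0 hB0 hA hB hconf.U_nonneg hconf.V_nonneg N x i0
    calc |P.dPotential N i0 x.1| * |x.1 i1 - x.1 i0 + β * (x.1 i1 - x.1 i0) ^ 3|
        ≤ ((A + N ^ 2 * B) * (1 + P.hamiltonian N x)) * (B * (1 + P.hamiltonian N x)) :=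
          mul_le_mul h1 (hVb x) (abs_nonneg _) (by have := hH0 x; positivity)
      _ = _ := by ring
  -- split `a₀ j_0` into the diagonal and the cross term
  have hsplit : ∀ x : PhaseSpace N, (x.2 i0 * partialQ i0 (P.hamiltonian N) x) * P.bondCurrent N i0 x =
      -(1 / 2) * (x.2 i0 ^ 2 * G x.1) + -(1 / 2) * (x.2 i0 * x.2 i1 * G x.1) := by
    intro x; rw [hj x, hdP x, hG]; ring
  -- integrability of both pieces under `μ_T`
  have hint1 : Integrable (fun x : PhaseSpace N => x.2 i0 ^ 2 * G x.1) (P.gibbsMeasure N T) := by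
    refine P.integrable_gibbsMeasure ?_
    obtain ⟨-, -, h⟩ := LightConeBondHeat.pinnedChain_integrable_momentum_pow_mul_posFun hω hl.le hβ.le γ N hT i0 hGc hGb
    exact h
  have hint2 : Integrable (fun x : PhaseSpace N => x.2 i0 * x.2 i1 * G x.1) (P.gibbsMeasure N T) := by
    refine P.integrable_gibbsMeasure ?_
    refine LightConeBondHeat.pinnedChain_integrable_mul_gibbsDensity_of_le_pow hω hl.le hβ.le γ N hT 4
      ((by fun_prop : Continuous fun x : PhaseSpace N => x.2 i0 * x.2 i1).mul (hGc.comp continuous_fst))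
      (C := (A + N ^ 2 * B) * B) fun x => ?_
    have hp0 := LinearResponseFTUR.abs_momentum_le_one_add hconf.U_nonneg hconf.V_nonneg x i0
    have hp1 := LinearResponseFTUR.abs_momentum_le_one_add hconf.U_nonneg hconf.V_nonneg x i1
    have hp1' : |x.2 i1| ≤ (1 + P.hamiltonian N x) := hp1
    rw [abs_mul, abs_mul]
    have hH := hH0 x
    calc |x.2 i0| * |x.2 i1| * |G x.1| ≤ (1 + P.hamiltonian N x) * (1 + P.hamiltonian N x) *
        ((A + N ^ 2 * B) * B * (1 + P.hamiltonian N x) ^ 2) := by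
          refine mul_le_mul (mul_le_mul hp0 hp1' (abs_nonneg _) (by positivity)) (hGb x) (abs_nonneg _) (by positivity)
      _ = (A + N ^ 2 * B) * B * (1 + P.hamiltonian N x) ^ 4 := by ring
  -- the cross term dies under `p_1 ↦ −p_1`
  have hcross : ∫ x, x.2 i0 * x.2 i1 * G x.1 ∂(P.gibbsMeasure N T) = 0 := by
    refine integral_eq_zero_of_momentumFlip_odd P N T i1 fun x => ?_
    rw [momentumFlip_snd_of_ne h01, momentumFlip_snd_self, momentumFlip_fst]
    ring
  -- the diagonal term: `p_0²` integrates to `T`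
  have hdiag : ∫ x, x.2 i0 ^ 2 * G x.1 ∂(P.gibbsMeasure N T) = T * ∫ x, G x.1 ∂(P.gibbsMeasure N T) := by
    rw [P.integral_gibbsMeasure, P.integral_gibbsMeasure (fun x => G x.1),
      LightConeBondHeat.pinnedChain_integral_momentum_sq_mul_posFun hω hl.le hβ.le γ N hT i0 hGc hGb]
    ring
  -- integration by parts in `q_0`: `∫ ∂_{q_0}H · V'(r) ρ = −T ∫ V''(r) ρ`
  have hHd : Differentiable ℝ (P.hamiltonian N) := (pinnedChain_contDiff_hamiltonian ω₂ lam β γ N (n := 1)).differentiable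
    one_ne_zero
  have hρc : Continuous (P.gibbsDensity N T) := pinnedChain_continuous_gibbsDensity ω₂ lam β γ N T
  have hFd : ∀ x : PhaseSpace N, HasLineDerivAt ℝ (fun z : PhaseSpace N => (z.1 i1 - z.1 i0) + β * (z.1 i1 - z.1 i0) ^ 3)
      (-(1 + 3 * β * (x.1 i1 - x.1 i0) ^ 2)) x ((Pi.single i0 1, 0) : PhaseSpace N) := by
    intro x
    unfold HasLineDerivAt
    have h : (fun t : ℝ => (fun z : PhaseSpace N => (z.1 i1 - z.1 i0) + β * (z.1 i1 - z.1 i0) ^ 3)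
        (x + t • ((Pi.single i0 1, 0) : PhaseSpace N))) =
        fun t => ((x.1 i1 - x.1 i0) - t) + β * ((x.1 i1 - x.1 i0) - t) ^ 3 := by
      funext t
      simp [h01.symm]
      ring
    rw [h]
    have h1 : HasDerivAt (fun t : ℝ => (x.1 i1 - x.1 i0) - t) (-1) 0 := by
      simpa using (hasDerivAt_id' (0 : ℝ)).const_sub (x.1 i1 - x.1 i0)
    refine (h1.add ((h1.pow 3).const_mul β)).congr_deriv ?_
    simp
    ring
  have hIBP : ∫ x, G x.1 * P.gibbsDensity N T x = -T * ∫ x, (1 + 3 * β * (x.1 i1 - x.1 i0) ^ 2) * P.gibbsDensity N T x := by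
    have hr2 : ∀ x : PhaseSpace N, (x.1 i1 - x.1 i0) ^ 2 ≤ 2 * P.hamiltonian N x := by
      intro x
      have h2 := P.bond_le_hamiltonian hconf.U_nonneg hconf.V_nonneg N x (k := i0) (l := i1) (by simp [hi0, hi1])
      have hV : P.V (x.1 i1 - x.1 i0) = (x.1 i1 - x.1 i0) ^ 2 / 2 + β * (x.1 i1 - x.1 i0) ^ 4 / 4 := rfl
      nlinarith [sq_nonneg ((x.1 i1 - x.1 i0) ^ 2), hβ.le]
    have hF'g : Integrable fun x : PhaseSpace N => -(1 + 3 * β * (x.1 i1 - x.1 i0) ^ 2) * P.gibbsDensity N T x := by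
      refine LightConeBondHeat.pinnedChain_integrable_mul_gibbsDensity_of_le_pow hω hl.le hβ.le γ N hT 1 (by fun_prop)
        (C := 1 + 6 * β) fun x => ?_
      have hH := hH0 x
      rw [abs_neg, abs_of_nonneg (by positivity)]
      nlinarith [hr2 x, hβ.le]
    have hFg : Integrable fun x : PhaseSpace N => ((x.1 i1 - x.1 i0) + β * (x.1 i1 - x.1 i0) ^ 3) * P.gibbsDensity N T x :=
      LightConeBondHeat.pinnedChain_integrable_mul_gibbsDensity_of_le_pow hω hl.le hβ.le γ N hT 1 (by fun_prop) (C := B)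
        fun x => by rw [pow_one]; exact hVb x
    have hFg' : Integrable fun x : PhaseSpace N => ((x.1 i1 - x.1 i0) + β * (x.1 i1 - x.1 i0) ^ 3) *
        (-(partialQ i0 (P.hamiltonian N) x / T) * P.gibbsDensity N T x) := by
      have h := LightConeBondHeat.pinnedChain_integrable_mul_gibbsDensity_of_le_pow hω hl.le hβ.le γ N hT 2
        (hGc.comp continuous_fst) hGb
      refine (h.const_mul (-T⁻¹)).congr (Eventually.of_forall fun x => ?_)
      simp only [Function.comp, hG, hdP x]
      ring
    have e := integral_mul_eq_neg_of_hasLineDerivAt_of_integrable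
      (F := fun z : PhaseSpace N => (z.1 i1 - z.1 i0) + β * (z.1 i1 - z.1 i0) ^ 3)
      (F' := fun x : PhaseSpace N => -(1 + 3 * β * (x.1 i1 - x.1 i0) ^ 2))
      (g := P.gibbsDensity N T) (g' := fun x => -(partialQ i0 (P.hamiltonian N) x / T) * P.gibbsDensity N T x)
      (v := ((Pi.single i0 1, 0) : PhaseSpace N)) hF'g hFg' hFg hFd
      (fun x => P.hasLineDerivAt_gibbsDensity (P.hasLineDerivAt_hamiltonian_unitQ hHd x i0))
    have lhs : ∫ x, ((x.1 i1 - x.1 i0) + β * (x.1 i1 - x.1 i0) ^ 3) *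
        (-(partialQ i0 (P.hamiltonian N) x / T) * P.gibbsDensity N T x) = -T⁻¹ * ∫ x, G x.1 * P.gibbsDensity N T x := by
      rw [← integral_const_mul]
      refine integral_congr_ae (Eventually.of_forall fun x => ?_)
      simp only [hG, hdP x]
      ring
    have rhs : ∫ x, -(1 + 3 * β * (x.1 i1 - x.1 i0) ^ 2) * P.gibbsDensity N T x =
        -∫ x, (1 + 3 * β * (x.1 i1 - x.1 i0) ^ 2) * P.gibbsDensity N T x := by
      rw [← integral_neg]
      refine integral_congr_ae (Eventually.of_forall fun x => ?_)
      ring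
    rw [lhs, rhs, neg_neg] at e
    have hTne : T ≠ 0 := hT.ne'
    field_simp at e
    linarith
  have hGμ : ∫ x, G x.1 ∂(P.gibbsMeasure N T) = -T * ∫ x, (1 + 3 * β * (x.1 i1 - x.1 i0) ^ 2) ∂(P.gibbsMeasure N T) := by
    rw [P.integral_gibbsMeasure (fun x => G x.1), P.integral_gibbsMeasure (fun x : PhaseSpace N => 1 + 3 * β * (x.1 i1 - x.1 i0) ^ 2),
      hIBP]
    ring
  -- assemble
  rw [integral_congr_ae (Eventually.of_forall hsplit), integral_add (hint1.const_mul _) (hint2.const_mul _),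
    integral_const_mul, integral_const_mul, hcross, hdiag, hGμ]
  ring

end Pinned

/-- **Registered helper `helper_kdContactPowerStatics` (stub S, line `kick-dipole-no-collapse`): GIBBS STATICS OF THE CONTACT
POWER PAIRING.**  For the pinned anharmonic chain (all parameters `> 0`), `T > 0` and `N ≥ 2`:
`∫ (p_0 ∂_{q_0}H) · J dμ_T = (T²/2) ∫ (1 + 3β(q_1 − q_0)²) dμ_T` and hence `≥ T²/2` — the initial value of the contact power
pairing `Φ_N(0)` of `helper_kdShortTimeReduction` is bounded below by `T²/2` UNIFORMLY IN `N` (the only `N`-uniform constant the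
short-time floor needs; `V'' = 1 + 3βr² ≥ 1` and `γ > 0`, `T > 0` enter here). -/
theorem helper_kdContactPowerStatics : ∀ ω₂ lam β γ : ℝ, 0 < ω₂ → 0 < lam → 0 < β → 0 < γ → ∀ T : ℝ, 0 < T → ∀ (N : ℕ) (hN : 2 ≤ N), ∫ z, (z.2 ⟨0, by omega⟩ * partialQ ⟨0, by omega⟩ ((pinnedChain ω₂ lam β γ).hamiltonian N) z) * totalCurrentObs (pinnedChain ω₂ lam β γ) N z ∂((pinnedChain ω₂ lam β γ).gibbsMeasure N T) = T ^ 2 / 2 * ∫ z, (1 + 3 * β * (z.1 ⟨1, hN⟩ - z.1 ⟨0, by omega⟩) ^ 2) ∂((pinnedChain ω₂ lam β γ).gibbsMeasure N T) ∧ T ^ 2 / 2 ≤ ∫ z, (z.2 ⟨0, by omega⟩ * partialQ ⟨0, by omega⟩ ((pinnedChain ω₂ lam β γ).hamiltonian N) z) * totalCurrentObs (pinnedChain ω₂ lam β γ) N z ∂((pinnedChain ω₂ lam β γ).gibbsMeasure N T) := by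
  intro ω₂ lam β γ hω hl hβ hγ T hT N hN2
  have hN : 0 < N := by omega
  set P := pinnedChain ω₂ lam β γ with hP
  haveI : IsProbabilityMeasure (P.gibbsMeasure N T) := pinnedChain_isProbabilityMeasure_gibbsMeasure hω hl.le hβ.le γ N hT
  obtain ⟨hϑ0, h2ϑ⟩ := LightConeBondHeat.quarter_inv_temp_admissible hT
  -- square integrability of `a₀` (continuous, `|a₀| ≤ K(1+H)² ≤ K C₀ e^{H/(4T)}`) and of every bond current
  have hconf := pinnedChain_isConfining hω hl.le hβ.le hγ.le
  obtain ⟨A, hA0, hA⟩ := hconf.exists_abs_deriv_U_le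
  obtain ⟨B, hB0, hB⟩ := hconf.exists_abs_deriv_V_le
  have hH1 : ContDiff ℝ 1 (P.hamiltonian N) := pinnedChain_contDiff_hamiltonian ω₂ lam β γ N
  have hac : Continuous fun z : PhaseSpace N => z.2 ⟨0, hN⟩ * partialQ ⟨0, hN⟩ (P.hamiltonian N) z :=
    (by fun_prop : Continuous fun z : PhaseSpace N => z.2 ⟨0, hN⟩).mul (P.continuous_partialQ_hamiltonian hH1 _)
  have hab : ∀ y : PhaseSpace N, |y.2 ⟨0, hN⟩ * partialQ ⟨0, hN⟩ (P.hamiltonian N) y| ≤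
      (A + N ^ 2 * B) * (2 * Real.exp (1 / (4 * T)) / (1 / (4 * T)) ^ 2) * Real.exp (1 / (4 * T) * P.hamiltonian N y) := by
    intro y
    have hp := LinearResponseFTUR.abs_momentum_le_one_add hconf.U_nonneg hconf.V_nonneg y ⟨0, hN⟩
    have hF := LinearResponseFTUR.abs_partialQ_hamiltonian_le hconf.U_nonneg hconf.V_nonneg hA0 hB0 hA hB
      hconf.differentiable_U hconf.differentiable_V y ⟨0, hN⟩
    have hH := pinnedChain_hamiltonian_nonneg hω.le hl.le hβ.le γ N y
    have hsq := one_add_sq_le_exp hH hϑ0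
    rw [abs_mul]
    calc |y.2 ⟨0, hN⟩| * |partialQ ⟨0, hN⟩ (P.hamiltonian N) y| ≤ (1 + P.hamiltonian N y) * ((A + N ^ 2 * B) * (1 + P.hamiltonian N y)) :=
          mul_le_mul hp hF (abs_nonneg _) (by positivity)
      _ = (A + N ^ 2 * B) * (1 + P.hamiltonian N y) ^ 2 := by ring
      _ ≤ (A + N ^ 2 * B) * ((2 * Real.exp (1 / (4 * T)) / (1 / (4 * T)) ^ 2) * Real.exp (1 / (4 * T) * P.hamiltonian N y)) := by
          gcongr
      _ = _ := by ring
  obtain ⟨ha2, -, -⟩ := pinnedChain_integral_sq_act_le hω hl.le hβ hγ hN hT hϑ0 h2ϑ hac hab 0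
  have hji : ∀ i : Fin N, Integrable (fun z => (z.2 ⟨0, hN⟩ * partialQ ⟨0, hN⟩ (P.hamiltonian N) z) * P.bondCurrent N i z)
      (P.gibbsMeasure N T) := by
    intro i
    obtain ⟨K, -, hKb⟩ := FiniteResponse.abs_bondCurrent_le_exp hω hl.le hβ hN hϑ0 i
    have hjc : Continuous (P.bondCurrent N i) := pinnedChain_continuous_bondCurrent ω₂ lam β γ N i
    obtain ⟨hj2, -, -⟩ := pinnedChain_integral_sq_act_le hω hl.le hβ hγ hN hT hϑ0 h2ϑ hjc hKb 0
    exact integrable_mul_of_sq_aesm hac.aestronglyMeasurable hjc.aestronglyMeasurable ha2 hj2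
  have hsum : ∫ z, (z.2 ⟨0, hN⟩ * partialQ ⟨0, hN⟩ (P.hamiltonian N) z) * totalCurrentObs P N z ∂(P.gibbsMeasure N T) =
      ∑ i : Fin N, ∫ z, (z.2 ⟨0, hN⟩ * partialQ ⟨0, hN⟩ (P.hamiltonian N) z) * P.bondCurrent N i z ∂(P.gibbsMeasure N T) := by
    rw [← integral_finsetSum _ fun i _ => hji i]
    refine integral_congr_ae (Eventually.of_forall fun z => ?_)
    simp only [totalCurrentObs_def, Finset.mul_sum]
  have hval : ∑ i : Fin N, ∫ z, (z.2 ⟨0, hN⟩ * partialQ ⟨0, hN⟩ (P.hamiltonian N) z) * P.bondCurrent N i z ∂(P.gibbsMeasure N T) =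
      T ^ 2 / 2 * ∫ z, (1 + 3 * β * (z.1 ⟨1, hN2⟩ - z.1 ⟨0, hN⟩) ^ 2) ∂(P.gibbsMeasure N T) := by
    rw [Finset.sum_eq_single ⟨0, hN⟩]
    · exact integral_contactPower_mul_bondCurrent_zero hω hl hβ hγ hN hT hN2
    · intro i _ hi
      exact integral_contactPower_mul_bondCurrent_of_ne hN (fun h => hi (Fin.ext h))
    · intro h; exact absurd (Finset.mem_univ _) h
  refine ⟨hsum.trans hval, ?_⟩
  rw [hsum, hval]
  have hint : Integrable (fun z : PhaseSpace N => 1 + 3 * β * (z.1 ⟨1, hN2⟩ - z.1 ⟨0, hN⟩) ^ 2) (P.gibbsMeasure N T) := by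
    refine P.integrable_gibbsMeasure ?_
    have hconf := pinnedChain_isConfining hω hl.le hβ.le hγ.le
    refine LightConeBondHeat.pinnedChain_integrable_mul_gibbsDensity_of_le_pow hω hl.le hβ.le γ N hT 1 (by fun_prop)
      (C := 1 + 6 * β) fun x => ?_
    have hH := pinnedChain_hamiltonian_nonneg hω.le hl.le hβ.le γ N x
    have h2 : (x.1 ⟨1, hN2⟩ - x.1 ⟨0, hN⟩) ^ 2 / 2 + β * (x.1 ⟨1, hN2⟩ - x.1 ⟨0, hN⟩) ^ 4 / 4 ≤
        (pinnedChain ω₂ lam β γ).hamiltonian N x :=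
      P.bond_le_hamiltonian hconf.U_nonneg hconf.V_nonneg N x (k := ⟨0, hN⟩) (l := ⟨1, hN2⟩) (by simp)
    rw [pow_one, abs_of_nonneg (by positivity)]
    nlinarith [sq_nonneg ((x.1 ⟨1, hN2⟩ - x.1 ⟨0, hN⟩) ^ 2), hβ.le,
      mul_nonneg hβ.le (sq_nonneg ((x.1 ⟨1, hN2⟩ - x.1 ⟨0, hN⟩) ^ 2))]
  have h1 : (1 : ℝ) ≤ ∫ z, (1 + 3 * β * (z.1 ⟨1, hN2⟩ - z.1 ⟨0, hN⟩) ^ 2) ∂(P.gibbsMeasure N T) := by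
    have h := integral_mono (integrable_const (1 : ℝ)) hint fun z => show (1 : ℝ) ≤ 1 + 3 * β * (z.1 ⟨1, hN2⟩ - z.1 ⟨0, hN⟩) ^ 2 by
      nlinarith [sq_nonneg (z.1 ⟨1, hN2⟩ - z.1 ⟨0, hN⟩), hβ.le]
    simpa using h
  have hT2 : 0 ≤ T ^ 2 / 2 := by positivity
  nlinarith


end Summit.AtomisticToContinuum.FouriersLaw.Cruxes.ConductanceLowerBound.KickDipoleNoCollapse

end
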